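import Summits.KontsevichZagierPeriods.KontsevichZagierPeriods.Theses.HurwitzMicroSectors
import Summits.KontsevichZagierPeriods.KontsevichZagierPeriods.Theorems.HurwitzMicroSectorsNormalFormPrinciplePiBoxTransfer
import Summits.KontsevichZagierPeriods.KontsevichZagierPeriods.Theorems.HurwitzMicroSectorsNormalFormPrincipleVariants2239

/-! TTRL-lite variant V2359 of stmt-KontsevichZagierPeriods-3869

Variant V2359 = `stub_boxRigidity` (BoxRigidity: two box-rational representations — domain the open
unit box, integrand `p/q` over `ℚ` — with equal values are KZ-equivalent) under the two-sided
small-case move `fix_nat:m'=3; bound_nat:m≤8` (right dimension frozen to `3`, left dimension `m ≤ 8`).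
Verdict of the attempt seat: **open** — this file is the exact-strength certificate, not a proof of
the variant. Freezing `m' = 3` next to `m ≤ 8` is idle: V2359 is EQUIVALENT to
**BoxVanishing in dimension `8`** — every box-rational representation on `(0,1)⁸` of value `0` is a
Kontsevich–Zagier relation, i.e. Conjecture 1 for box-rational periods of dimension `8`
(`stub_boxRigidity_var2359_iff_boxVanishing_eight`: `⇒` compare a box-rational representation of
value `0` with the zero representation on the `3`-box, itself a relation; `⇐` pad both sides to the
`8`-box by unit intervals and subtract on the common box, `boxRigidityLe_of_boxVanishing` of file
`…Variants2239`, value `0` by soundness), equivalently to BoxVanishing in every dimension `≤ 8`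
(`stub_boxRigidity_var2359_iff_boxVanishingLe_eight`, monotonicity `boxVanishing_mono`) and to
BoxRigidity with BOTH dimensions `≤ 8` (`stub_boxRigidity_var2359_iff_boxRigidityLe_eight`). Hence it
dominates every recorded-open sibling with `max j k ≤ 8` (`boxRigidityLe_of_stub_boxRigidity_var2359`,
`boxRigidityFix_of_stub_boxRigidity_var2359`: V2343 `m' = 2, m ≤ 5`, V2356 `m ≤ 5, m' ≤ 3`, …), and
already its dimension-`2` consequence (`boxVanishing_two_of_stub_boxRigidity_var2359`) decides every
`ℚ`-linear relation among the periods `∫∫_{(0,1)²} p/q` (Catalan's `G = ∫∫ dx dy/(1+x²y²)`, `π log 2`,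
`log² 2`, `Li₂`/Clausen values) in favour of the calculus, and its dimension-`3` consequence the case
split `ζ(3) ∈ ℚ + ℚπ²` — no argument in the tree or in print proves that; conversely
`KontsevichZagierPeriods → V2359` (`stub_boxRigidity_var2359_of_statement`), so a refutation of the
variant would refute Conjecture 1 for the tree's calculus (the only invariant of `KZ.relations` in the
tree is `eval`). The proved two-sided frontier is `max m m' ≤ 1` (`boxRigidity_of_le_one`, Baker).
Source: M. Kontsevich, D. Zagier, *Periods* (2001), §1.2 Conjecture 1 and rules 1)–3).
Pure proof file, no definitions. -/

-- `Summit.<Summit>.<Problem>` is the tree's mandated summit-side namespace (CONVENTIONS §2); for this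
-- single-conjunct summit the two coincide, so the duplicate is deliberate.
set_option linter.dupNamespace false

noncomputable section

namespace Summit.KontsevichZagierPeriods.KontsevichZagierPeriods.Theorems

open MeasureTheory Set
open Literature.NumberTheory.Transcendental Literature.NumberTheory.Transcendental.KZ
open Summit.KontsevichZagierPeriods.KontsevichZagierPeriods.Theses.HurwitzMicroSectors
open Summit.KontsevichZagierPeriods.HurwitzMicroSectors.NormalFormPrinciple.PiBox

/-! ## V2359 ⇒ BoxVanishing in every dimension `≤ 8` -/

/-- **V2359 ⇒ BoxVanishing(dim ≤ 8)**: compare a box-rational `N : IntegralRep m`, `m ≤ 8`, of value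
`0` with the zero representation on the `3`-box (box-rational, value `0`, itself a relation).
[cite: KontsevichZagier2001, §1.2 Conjecture 1] -/
theorem boxVanishingLe_eight_of_stub_boxRigidity_var2359
    (h : ∀ (m : ℕ) (N : IntegralRep m) (N' : IntegralRep 3), m ≤ 8 → N.domain = {x | ∀ i, x i ∈ Set.Ioo (0:ℝ) 1} → N.IsRational → N'.domain = {x | ∀ i, x i ∈ Set.Ioo (0:ℝ) 1} → N'.IsRational → N.value = N'.value → Equivalent N N') :
    ∀ (m : ℕ) (N : IntegralRep m), m ≤ 8 → N.domain = {x | ∀ i, x i ∈ Set.Ioo (0:ℝ) 1} →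
      N.IsRational → N.value = 0 → of N ∈ relations := by
  intro m N hm hNd hNr hv
  obtain ⟨Z, hZd, hZi⟩ := exists_zeroRep (isSemialgebraic_box 3)
  have hZ : of Z ∈ relations := of_mem_relations_of_eqOn_zero Z (by simp [hZi, EqOn])
  have hZv : Z.value = 0 := by simp [IntegralRep.value, hZi]
  have hZr : Z.IsRational := ⟨0, 1, fun x _ => by simp, fun x _ => by simp [hZi]⟩
  have h' : of N - of Z ∈ relations := h m N Z hm hNd hNr hZd hZr (by rw [hv, hZv])
  have := relations.add_mem h' hZ
  rwa [sub_add_cancel] at this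

/-- **V2359 ⇒ BoxVanishing in dimension `3`** (the frozen side `(0,1)³` carries Conjecture 1 for all
rational integrands over `ℚ` on the cube: e.g. the case split `ζ(3) ∈ ℚ + ℚπ²`, `π³` against
`ℚ + ℚπ + ℚπ² + …`, decided in favour of the calculus). [cite: KontsevichZagier2001, §1.2 Conjecture 1] -/
theorem boxVanishing_three_of_stub_boxRigidity_var2359
    (h : ∀ (m : ℕ) (N : IntegralRep m) (N' : IntegralRep 3), m ≤ 8 → N.domain = {x | ∀ i, x i ∈ Set.Ioo (0:ℝ) 1} → N.IsRational → N'.domain = {x | ∀ i, x i ∈ Set.Ioo (0:ℝ) 1} → N'.IsRational → N.value = N'.value → Equivalent N N')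
    (N : IntegralRep 3) (hNd : N.domain = {x | ∀ i, x i ∈ Set.Ioo (0:ℝ) 1}) (hNr : N.IsRational)
    (hv : N.value = 0) : of N ∈ relations :=
  boxVanishingLe_eight_of_stub_boxRigidity_var2359 h 3 N (by norm_num) hNd hNr hv

/-- **V2359 ⇒ BoxVanishing in dimension `2`** — the first open dimension: every `ℚ`-linear relation
among the box periods `∫∫_{(0,1)²} p/q` (`π log 2`, `log² 2`, Catalan's `G`, `Li₂` and Clausen values, …)
would be a KZ relation. [cite: KontsevichZagier2001, §1.2 Conjecture 1] -/
theorem boxVanishing_two_of_stub_boxRigidity_var2359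
    (h : ∀ (m : ℕ) (N : IntegralRep m) (N' : IntegralRep 3), m ≤ 8 → N.domain = {x | ∀ i, x i ∈ Set.Ioo (0:ℝ) 1} → N.IsRational → N'.domain = {x | ∀ i, x i ∈ Set.Ioo (0:ℝ) 1} → N'.IsRational → N.value = N'.value → Equivalent N N')
    (N : IntegralRep 2) (hNd : N.domain = {x | ∀ i, x i ∈ Set.Ioo (0:ℝ) 1}) (hNr : N.IsRational)
    (hv : N.value = 0) : of N ∈ relations :=
  boxVanishingLe_eight_of_stub_boxRigidity_var2359 h 2 N (by norm_num) hNd hNr hv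

/-! ## BoxVanishing in dimension `8` ⇒ V2359 -/

/-- **BoxVanishing(`8`) ⇒ V2359**: pad both representations to `(0,1)⁸` by unit intervals (`pad_le`:
one Newton–Leibniz move and two null faces per step), subtract the integrands on the common box
(`sub_same`, rule 1b)); the difference is box-rational of value `0` by soundness, hence a relation
(`boxRigidityLe_of_boxVanishing`, file `…Variants2239`, at `j = K = 8`, `k = 3`).
[cite: KontsevichZagier2001, §1.2 Conjecture 1] -/
theorem stub_boxRigidity_var2359_of_boxVanishing_eight
    (hvan : ∀ N : IntegralRep 8, N.domain = {x | ∀ i, x i ∈ Set.Ioo (0:ℝ) 1} → N.IsRational →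
      N.value = 0 → of N ∈ relations) :
    ∀ (m : ℕ) (N : IntegralRep m) (N' : IntegralRep 3), m ≤ 8 → N.domain = {x | ∀ i, x i ∈ Set.Ioo (0:ℝ) 1} → N.IsRational → N'.domain = {x | ∀ i, x i ∈ Set.Ioo (0:ℝ) 1} → N'.IsRational → N.value = N'.value → Equivalent N N' :=
  fun m N N' hm =>
    boxRigidityLe_of_boxVanishing (j := 8) (k := 3) (K := 8) le_rfl (by norm_num) hvan m 3 N N' le_rfl hm

/-! ## The variant V2359 itself: exact strength -/

/-- **V2359 ⟺ BoxVanishing in dimension `8`** (every box-rational representation on `(0,1)⁸` of value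
`0` is a relation): Conjecture 1 for box-rational periods of dimension `8`, open.
[cite: KontsevichZagier2001, §1.2 Conjecture 1] -/
theorem stub_boxRigidity_var2359_iff_boxVanishing_eight :
    (∀ (m : ℕ) (N : IntegralRep m) (N' : IntegralRep 3), m ≤ 8 → N.domain = {x | ∀ i, x i ∈ Set.Ioo (0:ℝ) 1} → N.IsRational → N'.domain = {x | ∀ i, x i ∈ Set.Ioo (0:ℝ) 1} → N'.IsRational → N.value = N'.value → Equivalent N N') ↔
    (∀ N : IntegralRep 8, N.domain = {x | ∀ i, x i ∈ Set.Ioo (0:ℝ) 1} → N.IsRational →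
      N.value = 0 → of N ∈ relations) :=
  ⟨fun h N => boxVanishingLe_eight_of_stub_boxRigidity_var2359 h 8 N le_rfl,
    stub_boxRigidity_var2359_of_boxVanishing_eight⟩

/-- **V2359 ⟺ BoxVanishing(dim ≤ 8)**: the variant is exactly "every rational function over `ℚ` on
`(0,1)^m`, `m ≤ 8`, absolutely integrable with integral `0`, is a KZ relation" (BoxVanishing descends
along padding, `boxVanishing_mono`). [cite: KontsevichZagier2001, §1.2 Conjecture 1] -/
theorem stub_boxRigidity_var2359_iff_boxVanishingLe_eight :
    (∀ (m : ℕ) (N : IntegralRep m) (N' : IntegralRep 3), m ≤ 8 → N.domain = {x | ∀ i, x i ∈ Set.Ioo (0:ℝ) 1} → N.IsRational → N'.domain = {x | ∀ i, x i ∈ Set.Ioo (0:ℝ) 1} → N'.IsRational → N.value = N'.value → Equivalent N N') ↔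
    (∀ (m : ℕ) (N : IntegralRep m), m ≤ 8 → N.domain = {x | ∀ i, x i ∈ Set.Ioo (0:ℝ) 1} →
      N.IsRational → N.value = 0 → of N ∈ relations) :=
  ⟨boxVanishingLe_eight_of_stub_boxRigidity_var2359,
    fun hvan => stub_boxRigidity_var2359_of_boxVanishing_eight fun N => hvan 8 N le_rfl⟩

/-- **V2359 ⟺ BoxRigidity with both dimensions `≤ 8`**: the frozen `m' = 3` is idle next to `m ≤ 8`
(the honest strength of the variant: Conjecture 1 for all pairs of rational integrands over `ℚ` on the
open unit boxes of dimension at most `8`). [cite: KontsevichZagier2001, §1.2 Conjecture 1] -/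
theorem stub_boxRigidity_var2359_iff_boxRigidityLe_eight :
    (∀ (m : ℕ) (N : IntegralRep m) (N' : IntegralRep 3), m ≤ 8 → N.domain = {x | ∀ i, x i ∈ Set.Ioo (0:ℝ) 1} → N.IsRational → N'.domain = {x | ∀ i, x i ∈ Set.Ioo (0:ℝ) 1} → N'.IsRational → N.value = N'.value → Equivalent N N') ↔
    (∀ (m m' : ℕ) (N : IntegralRep m) (N' : IntegralRep m'), m ≤ 8 → m' ≤ 8 →
      N.domain = {x | ∀ i, x i ∈ Set.Ioo (0:ℝ) 1} → N.IsRational →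
      N'.domain = {x | ∀ i, x i ∈ Set.Ioo (0:ℝ) 1} → N'.IsRational →
      N.value = N'.value → Equivalent N N') :=
  ⟨fun h m m' N N' hm hm' =>
      boxRigidityLe_of_boxVanishing (j := 8) (k := 8) (K := 8) le_rfl le_rfl
        (stub_boxRigidity_var2359_iff_boxVanishing_eight.1 h) m m' N N' hm' hm,
    fun h m N N' hm => h m 3 N N' hm (by norm_num)⟩

/-- **V2359 dominates every jointly bounded sibling with `max j k ≤ 8`**: V2359 ⇒
`BoxRigidity(m ≤ j, m' ≤ k)` whenever `max j k ≤ 8` — in particular the recorded-open V2356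
(`m ≤ 5, m' ≤ 3`) and all `≤ 2 … ≤ 7` rungs; so V2359 is open a fortiori.
[cite: KontsevichZagier2001, §1.2 Conjecture 1] -/
theorem boxRigidityLe_of_stub_boxRigidity_var2359 (j k : ℕ) (hjk : max j k ≤ 8)
    (h : ∀ (m : ℕ) (N : IntegralRep m) (N' : IntegralRep 3), m ≤ 8 → N.domain = {x | ∀ i, x i ∈ Set.Ioo (0:ℝ) 1} → N.IsRational → N'.domain = {x | ∀ i, x i ∈ Set.Ioo (0:ℝ) 1} → N'.IsRational → N.value = N'.value → Equivalent N N') :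
    ∀ (m m' : ℕ) (N : IntegralRep m) (N' : IntegralRep m'), m ≤ j → m' ≤ k →
      N.domain = {x | ∀ i, x i ∈ Set.Ioo (0:ℝ) 1} → N.IsRational →
      N'.domain = {x | ∀ i, x i ∈ Set.Ioo (0:ℝ) 1} → N'.IsRational →
      N.value = N'.value → Equivalent N N' :=
  fun m m' N N' hm hm' =>
    boxRigidityLe_of_boxVanishing (le_of_max_le_left hjk) (le_of_max_le_right hjk)
      (stub_boxRigidity_var2359_iff_boxVanishing_eight.1 h) m m' N N' hm' hm

/-- **Any frozen right dimension `m' ≤ 8` is the same variant or weaker**: V2359 ⇒ the sibling with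
the right dimension frozen to any `m' ≤ 8` and `m ≤ j ≤ 8` (e.g. V2343: `m' = 2`, `m ≤ 5`).
[cite: KontsevichZagier2001, §1.2 Conjecture 1] -/
theorem boxRigidityFix_of_stub_boxRigidity_var2359 (j m' : ℕ) (hj : j ≤ 8) (hm' : m' ≤ 8)
    (h : ∀ (m : ℕ) (N : IntegralRep m) (N' : IntegralRep 3), m ≤ 8 → N.domain = {x | ∀ i, x i ∈ Set.Ioo (0:ℝ) 1} → N.IsRational → N'.domain = {x | ∀ i, x i ∈ Set.Ioo (0:ℝ) 1} → N'.IsRational → N.value = N'.value → Equivalent N N') :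
    ∀ (m : ℕ) (N : IntegralRep m) (N' : IntegralRep m'), m ≤ j →
      N.domain = {x | ∀ i, x i ∈ Set.Ioo (0:ℝ) 1} → N.IsRational →
      N'.domain = {x | ∀ i, x i ∈ Set.Ioo (0:ℝ) 1} → N'.IsRational →
      N.value = N'.value → Equivalent N N' :=
  fun m N N' hm => boxRigidityLe_of_stub_boxRigidity_var2359 8 8 (by norm_num) h m m' N N'
    (hm.trans hj) hm'

/-! ## The other side: the variant is implied by the Summit -/

/-- **The parent leaf ⇒ V2359** (specialisation `m' := 3`; the converse is not claimed — the parent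
is BoxVanishing in ALL dimensions). [cite: KontsevichZagier2001, §1.2 Conjecture 1] -/
theorem stub_boxRigidity_var2359_of_parent
    (h : ∀ (m m' : ℕ) (N : IntegralRep m) (N' : IntegralRep m'), N.domain = {x | ∀ i, x i ∈ Set.Ioo (0:ℝ) 1} → N.IsRational → N'.domain = {x | ∀ i, x i ∈ Set.Ioo (0:ℝ) 1} → N'.IsRational → N.value = N'.value → Equivalent N N') :
    ∀ (m : ℕ) (N : IntegralRep m) (N' : IntegralRep 3), m ≤ 8 → N.domain = {x | ∀ i, x i ∈ Set.Ioo (0:ℝ) 1} → N.IsRational → N'.domain = {x | ∀ i, x i ∈ Set.Ioo (0:ℝ) 1} → N'.IsRational → N.value = N'.value → Equivalent N N' :=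
  fun m N N' _ => h m 3 N N'

/-- **`KontsevichZagierPeriods ⇒ V2359`**: the variant is a special case of Conjecture 1 for the
tree's calculus (`leaves_of_statement`) — a refutation of the variant would refute the Summit.
[cite: KontsevichZagier2001, §1.2 Conjecture 1] -/
theorem stub_boxRigidity_var2359_of_statement (h : _root_.KontsevichZagierPeriods) :
    ∀ (m : ℕ) (N : IntegralRep m) (N' : IntegralRep 3), m ≤ 8 → N.domain = {x | ∀ i, x i ∈ Set.Ioo (0:ℝ) 1} → N.IsRational → N'.domain = {x | ∀ i, x i ∈ Set.Ioo (0:ℝ) 1} → N'.IsRational → N.value = N'.value → Equivalent N N' :=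
  stub_boxRigidity_var2359_of_parent (leaves_of_statement h).1

end Summit.KontsevichZagierPeriods.KontsevichZagierPeriods.Theorems
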